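import Summits.Ventures.HodgeRepro2.T5PoincareMeasure
import Summits.Ventures.HodgeRepro2.T5SU11Unimodular

/-!
# The Haar measure of `SU(1,1)` through the disc, I: the section `s(z)`, the rotation subgroup, the cocycle

`SU(1,1)` acts on the disc `𝔻 = ball 0 1` by Möbius maps with `K = {diag(u, ū)} ≅ Circle` the
stabiliser of `0`, and every `z ∈ 𝔻` is `s(z) · 0` for the section
`s(z) = (1 - |z|²)^{-1/2} !![1, z; z̄, 1] ∈ SU(1,1)` (the positive hermitian square root).  The
map `Φ : ℂ × Circle → SU(1,1)`, `(z, u) ↦ s(z) k(u)`, carries the product of the Poincaré measure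
of the disc (`T5PoincareMeasure.poincare`) and a Haar measure of the circle to a LEFT-INVARIANT
measure `ν` on `SU(1,1)` (the cocycle `g s(z) = s(g·z) k(u₀)`, the invariance of the Haar measure of
`K`, and the Möbius invariance `map_mobius_poincare`), finite on compact sets; by Mathlib's
uniqueness of Haar measures, `ν = c · μ` for every Haar measure `μ` on `SU(1,1)` with `c > 0`.
This is the support map's «Rühl's measure IS a Haar measure on `SU(1,1)`» (N4.3 / P2′) up to the
normalisation constant `c`: `∫_G f dμ = c⁻¹ ∫_𝔻 (1 - |z|²)⁻² ∫_K f(s(z) k) dk dA(z)`.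

Blind lane: Mathlib + own prefix only; no sorry; axioms ⊆ {propext, Classical.choice, Quot.sound}.
-/

namespace Summit.Ventures.HodgeRepro2.T5SU11Fibration

open MeasureTheory MeasureTheory.Measure Metric Topology T5PoincareDensity T5PoincareInvariance
  T5PoincareMeasure T5SU11Unimodular T5UnitaryBound
open scoped ENNReal NNReal

/-! ### The group elements `su11 a b` as elements of the subgroup `SU11` -/

/-- `su11 a b` with `|a|² - |b|² = 1` as an element of the subgroup `SU11 ⊂ SL₂(ℂ)`. -/
noncomputable def toSU11 (a b : ℂ) (h : Complex.normSq a - Complex.normSq b = 1) : SU11 :=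
  ⟨⟨su11 a b, (su11_memU11_det_one a b h).2⟩, (mem_SU11_iff _).mpr (su11_memU11_det_one a b h).1⟩

/-- The matrix of `toSU11 a b h`. -/
@[simp] lemma coe_toSU11 (a b : ℂ) (h : Complex.normSq a - Complex.normSq b = 1) :
    ((toSU11 a b h : Matrix.SpecialLinearGroup (Fin 2) ℂ) : Matrix (Fin 2) (Fin 2) ℂ) = su11 a b :=
  rfl

/-- The matrix of an element of `SU11` is `su11 (g 0 0) (g 0 1)`. -/
lemma coe_eq_su11 (g : SU11) :
    ((g : Matrix.SpecialLinearGroup (Fin 2) ℂ) : Matrix (Fin 2) (Fin 2) ℂ) =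
      su11 (((g : Matrix.SpecialLinearGroup (Fin 2) ℂ) : Matrix (Fin 2) (Fin 2) ℂ) 0 0)
        (((g : Matrix.SpecialLinearGroup (Fin 2) ℂ) : Matrix (Fin 2) (Fin 2) ℂ) 0 1) :=
  eq_su11_of_memU11_det_one ((mem_SU11_iff _).mp g.2) (Matrix.SpecialLinearGroup.det_coe _)

/-- `|g₀₀|² - |g₀₁|² = 1` for `g ∈ SU11`. -/
lemma normSq_sub_normSq (g : SU11) :
    Complex.normSq (((g : Matrix.SpecialLinearGroup (Fin 2) ℂ) : Matrix (Fin 2) (Fin 2) ℂ) 0 0) -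
      Complex.normSq (((g : Matrix.SpecialLinearGroup (Fin 2) ℂ) : Matrix (Fin 2) (Fin 2) ℂ) 0 1) = 1 :=
  normSq_sub_normSq_of_memU11_det_one ((mem_SU11_iff _).mp g.2)
    (Matrix.SpecialLinearGroup.det_coe _)

/-- The matrix of `g⁻¹` for `g = su11 a b`: `su11 ā (-b)`. -/
lemma coe_inv_eq (a b : ℂ) (h : Complex.normSq a - Complex.normSq b = 1) :
    (((toSU11 a b h)⁻¹ : SU11) : Matrix.SpecialLinearGroup (Fin 2) ℂ) = (toSU11 a b h : Matrix.SpecialLinearGroup (Fin 2) ℂ)⁻¹ :=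
  rfl

/-- `(toSU11 a b)⁻¹ = toSU11 ā (-b)`. -/
lemma inv_toSU11 (a b : ℂ) (h : Complex.normSq a - Complex.normSq b = 1) :
    (toSU11 a b h)⁻¹ = toSU11 ((starRingEnd ℂ) a) (-b) (normSq_conj_sub_normSq_neg a b h) := by
  apply inv_eq_of_mul_eq_one_right
  apply Subtype.ext
  apply Subtype.ext
  show su11 a b * su11 ((starRingEnd ℂ) a) (-b) = 1
  exact su11_mul_inv a b h

/-! ### The orbit map, the rotation subgroup and the section -/

/-- The orbit map `g ↦ g · 0 ∈ 𝔻`. -/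
noncomputable def orbit (g : SU11) : ℂ :=
  mobius ((g : Matrix.SpecialLinearGroup (Fin 2) ℂ) : Matrix (Fin 2) (Fin 2) ℂ) 0

/-- `orbit (toSU11 a b) = b / ā`. -/
lemma orbit_toSU11 (a b : ℂ) (h : Complex.normSq a - Complex.normSq b = 1) :
    orbit (toSU11 a b h) = b / (starRingEnd ℂ) a := by
  unfold orbit
  rw [coe_toSU11, mobius_su11]
  simp

/-- The orbit of `0` lies in the disc. -/
lemma orbit_mem_ball (g : SU11) : orbit g ∈ ball 0 1 := by
  rw [mem_ball_iff_normSq]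
  exact normSq_mobius_lt_one_of_memU11_det_one ((mem_SU11_iff _).mp g.2)
    (Matrix.SpecialLinearGroup.det_coe _) (by simp)

/-- `orbit (g * h) = g · orbit h`. -/
lemma orbit_mul (g h : SU11) :
    orbit (g * h) = mobius ((g : Matrix.SpecialLinearGroup (Fin 2) ℂ) : Matrix (Fin 2) (Fin 2) ℂ) (orbit h) := by
  unfold orbit
  rw [Subgroup.coe_mul, Matrix.SpecialLinearGroup.coe_mul]
  exact mobius_mul_of_memU11_det_one ((mem_SU11_iff _).mp g.2) (Matrix.SpecialLinearGroup.det_coe _)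
    ((mem_SU11_iff _).mp h.2) (Matrix.SpecialLinearGroup.det_coe _) (by simp)

/-- The Möbius action of `g ∈ SU11` preserves the disc. -/
lemma mobius_mem_ball (g : SU11) {z : ℂ} (hz : z ∈ ball 0 1) :
    mobius ((g : Matrix.SpecialLinearGroup (Fin 2) ℂ) : Matrix (Fin 2) (Fin 2) ℂ) z ∈ ball 0 1 := by
  rw [mem_ball_iff_normSq] at hz ⊢
  exact normSq_mobius_lt_one_of_memU11_det_one ((mem_SU11_iff _).mp g.2)
    (Matrix.SpecialLinearGroup.det_coe _) hz

/-- The rotation subgroup `K ≅ Circle`: `u ↦ diag(u, ū)`. -/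
noncomputable def rot : Circle →* SU11 where
  toFun u := toSU11 (u : ℂ) 0
    (by rw [map_zero, sub_zero, Complex.normSq_eq_norm_sq, Circle.norm_coe u, one_pow])
  map_one' := by
    apply Subtype.ext; apply Subtype.ext
    show su11 1 0 = 1
    ext i j
    fin_cases i <;> fin_cases j <;> simp [su11]
  map_mul' u v := by
    apply Subtype.ext; apply Subtype.ext
    show su11 ((u * v : Circle) : ℂ) 0 = su11 (u : ℂ) 0 * su11 (v : ℂ) 0
    ext i j
    fin_cases i <;> fin_cases j <;> simp [su11, Matrix.mul_apply, Fin.sum_univ_two]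

/-- The matrix of `rot u`. -/
@[simp] lemma coe_rot (u : Circle) :
    ((rot u : Matrix.SpecialLinearGroup (Fin 2) ℂ) : Matrix (Fin 2) (Fin 2) ℂ) = su11 (u : ℂ) 0 :=
  rfl

/-- `rot u` fixes `0`. -/
lemma orbit_rot (u : Circle) : orbit (rot u) = 0 := by
  unfold orbit
  rw [coe_rot, mobius_su11]
  simp

/-- **The stabiliser of `0` is the rotation subgroup**: `orbit g = 0 → ∃ u, g = rot u`. -/
theorem exists_rot_of_orbit_eq_zero (g : SU11) (hg : orbit g = 0) : ∃ u : Circle, g = rot u := by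
  set a := ((g : Matrix.SpecialLinearGroup (Fin 2) ℂ) : Matrix (Fin 2) (Fin 2) ℂ) 0 0 with ha
  set b := ((g : Matrix.SpecialLinearGroup (Fin 2) ℂ) : Matrix (Fin 2) (Fin 2) ℂ) 0 1 with hb
  have hab : Complex.normSq a - Complex.normSq b = 1 := normSq_sub_normSq g
  have hmat : ((g : Matrix.SpecialLinearGroup (Fin 2) ℂ) : Matrix (Fin 2) (Fin 2) ℂ) = su11 a b := coe_eq_su11 g
  have ha0 : (starRingEnd ℂ) a ≠ 0 := by
    intro h0
    have : a = 0 := by simpa using congr_arg (starRingEnd ℂ) h0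
    rw [this, map_zero, zero_sub] at hab
    have := Complex.normSq_nonneg b
    linarith
  have hb0 : b = 0 := by
    unfold orbit at hg
    rw [hmat, mobius_su11] at hg
    simp only [mul_zero, zero_add] at hg
    exact (div_eq_zero_iff.mp hg).resolve_right ha0
  have hna : Complex.normSq a = 1 := by rw [hb0, map_zero, sub_zero] at hab; exact hab
  refine ⟨⟨a, mem_sphere_zero_iff_norm.mpr ?_⟩, ?_⟩
  · exact (sq_eq_sq₀ (norm_nonneg _) zero_le_one).mp (by rw [← Complex.normSq_eq_norm_sq, hna, one_pow])
  · apply Subtype.ext; apply Subtype.ext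
    rw [hmat, hb0]
    rfl

/-- The clamped point `z` if `z ∈ 𝔻`, else `0` (so that the section is defined everywhere). -/
noncomputable def clamp (z : ℂ) : ℂ := if Complex.normSq z < 1 then z else 0

/-- `clamp z ∈ 𝔻`. -/
lemma normSq_clamp_lt_one (z : ℂ) : Complex.normSq (clamp z) < 1 := by
  unfold clamp
  split_ifs with h
  · exact h
  · simp

/-- `clamp z = z` on the disc. -/
lemma clamp_of_mem_ball {z : ℂ} (hz : z ∈ ball 0 1) : clamp z = z := by
  rw [mem_ball_iff_normSq] at hz
  unfold clamp
  rw [if_pos hz]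

/-- The scaling factor `r(z) = (1 - |clamp z|²)^{-1/2}`. -/
noncomputable def rad (z : ℂ) : ℝ := (Real.sqrt (1 - Complex.normSq (clamp z)))⁻¹

/-- `rad z > 0`. -/
lemma rad_pos (z : ℂ) : 0 < rad z := by
  unfold rad
  have := normSq_clamp_lt_one z
  exact inv_pos.mpr (Real.sqrt_pos.mpr (by linarith))

/-- `|r|² - |r · clamp z|² = 1`. -/
lemma normSq_rad_sub (z : ℂ) :
    Complex.normSq (rad z : ℂ) - Complex.normSq ((rad z : ℂ) * clamp z) = 1 := by
  rw [map_mul, Complex.normSq_ofReal, ← mul_one_sub]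
  unfold rad
  have h := normSq_clamp_lt_one z
  have hpos : 0 < 1 - Complex.normSq (clamp z) := by linarith
  rw [← mul_inv, Real.mul_self_sqrt hpos.le, inv_mul_cancel₀ hpos.ne']

/-- **The section** `s(z) = r(z) · !![1, z; z̄, 1] ∈ SU11` (with `clamp` outside the disc). -/
noncomputable def sec (z : ℂ) : SU11 :=
  toSU11 (rad z : ℂ) ((rad z : ℂ) * clamp z) (normSq_rad_sub z)

/-- `s(z) · 0 = z` on the disc. -/
lemma orbit_sec {z : ℂ} (hz : z ∈ ball 0 1) : orbit (sec z) = z := by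
  unfold sec
  rw [orbit_toSU11, clamp_of_mem_ball hz, Complex.conj_ofReal]
  have : (rad z : ℂ) ≠ 0 := by exact_mod_cast (rad_pos z).ne'
  field_simp

/-- **The cocycle identity**: for `g ∈ SU11` and `z ∈ 𝔻` there is `u₀ ∈ Circle` with
`g · s(z) = s(g·z) · rot u₀`. -/
theorem exists_cocycle (g : SU11) {z : ℂ} (hz : z ∈ ball 0 1) :
    ∃ u₀ : Circle, g * sec z =
      sec (mobius ((g : Matrix.SpecialLinearGroup (Fin 2) ℂ) : Matrix (Fin 2) (Fin 2) ℂ) z) * rot u₀ := by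
  set w := mobius ((g : Matrix.SpecialLinearGroup (Fin 2) ℂ) : Matrix (Fin 2) (Fin 2) ℂ) z with hw
  have hwb : w ∈ ball 0 1 := mobius_mem_ball g hz
  set h := (sec w)⁻¹ * (g * sec z) with hh
  have horb : orbit h = 0 := by
    have e1 : orbit (g * sec z) = w := by rw [orbit_mul, orbit_sec hz]
    rw [hh, orbit_mul, e1]
    calc mobius (((sec w)⁻¹ : SU11) : Matrix (Fin 2) (Fin 2) ℂ) w
        = mobius (((sec w)⁻¹ : SU11) : Matrix (Fin 2) (Fin 2) ℂ) (orbit (sec w)) := by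
          rw [orbit_sec hwb]
      _ = orbit ((sec w)⁻¹ * sec w) := (orbit_mul _ _).symm
      _ = orbit 1 := by rw [inv_mul_cancel]
      _ = 0 := by
          unfold orbit
          rw [OneMemClass.coe_one, Matrix.SpecialLinearGroup.coe_one, mobius_one]
  obtain ⟨u₀, hu₀⟩ := exists_rot_of_orbit_eq_zero h horb
  refine ⟨u₀, ?_⟩
  rw [← hu₀, hh, mul_inv_cancel_left]

/-! ### Measurable structure -/

/-- The Poincaré measure is σ-finite (a density with finite values on the σ-finite
`volume.restrict (ball 0 1)`). -/
instance instSigmaFinitePoincare : SigmaFinite poincare := by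
  unfold poincare
  infer_instance

/-- The Borel σ-algebra of `M₂(ℂ)` (the product σ-algebra). -/
noncomputable instance instMeasurableSpaceMatrix : MeasurableSpace (Matrix (Fin 2) (Fin 2) ℂ) :=
  inferInstanceAs (MeasurableSpace (Fin 2 → Fin 2 → ℂ))

/-- `M₂(ℂ)` is a Borel space. -/
noncomputable instance instBorelSpaceMatrix : BorelSpace (Matrix (Fin 2) (Fin 2) ℂ) :=
  inferInstanceAs (BorelSpace (Fin 2 → Fin 2 → ℂ))

/-- The subtype σ-algebra of `SL₂(ℂ) ⊂ M₂(ℂ)`. -/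
noncomputable instance instMeasurableSpaceSL : MeasurableSpace (Matrix.SpecialLinearGroup (Fin 2) ℂ) :=
  Subtype.instMeasurableSpace

/-- `SL₂(ℂ)` is a Borel space. -/
noncomputable instance instBorelSpaceSL : BorelSpace (Matrix.SpecialLinearGroup (Fin 2) ℂ) :=
  Subtype.borelSpace _

/-- `clamp` is measurable. -/
lemma measurable_clamp : Measurable clamp := by
  unfold clamp
  exact Measurable.ite (measurableSet_lt Complex.continuous_normSq.measurable measurable_const)
    measurable_id measurable_const

/-- `rad` is measurable. -/
lemma measurable_rad : Measurable rad := by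
  unfold rad
  exact (Real.continuous_sqrt.measurable.comp
    (measurable_const.sub (Complex.continuous_normSq.measurable.comp measurable_clamp))).inv

/-- The matrix of `sec z` is measurable in `z`. -/
lemma measurable_coe_sec :
    Measurable fun z : ℂ => ((sec z : Matrix.SpecialLinearGroup (Fin 2) ℂ) : Matrix (Fin 2) (Fin 2) ℂ) := by
  have h : (fun z : ℂ => ((sec z : Matrix.SpecialLinearGroup (Fin 2) ℂ) : Matrix (Fin 2) (Fin 2) ℂ)) =
      fun z => su11 (rad z : ℂ) ((rad z : ℂ) * clamp z) := rfl
  rw [h]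
  refine measurable_pi_iff.mpr fun i => measurable_pi_iff.mpr fun j => ?_
  have hr : Measurable fun z : ℂ => (rad z : ℂ) := Complex.measurable_ofReal.comp measurable_rad
  have hrz : Measurable fun z : ℂ => (rad z : ℂ) * clamp z := hr.mul measurable_clamp
  fin_cases i <;> fin_cases j
  · simpa [su11] using hr
  · simpa [su11] using hrz
  · simp [su11]
    exact hr.mul (Complex.continuous_conj.measurable.comp measurable_clamp)
  · simpa [su11] using hr

/-- `sec` is measurable. -/
lemma measurable_sec : Measurable sec :=
  (measurable_coe_sec.subtype_mk).subtype_mk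

/-- `rot` is continuous. -/
lemma continuous_rot : Continuous rot := by
  apply Continuous.subtype_mk
  apply Continuous.subtype_mk
  show Continuous fun u : Circle => su11 (u : ℂ) 0
  refine continuous_pi fun i => continuous_pi fun j => ?_
  have hc : Continuous fun u : Circle => (u : ℂ) := continuous_subtype_val
  fin_cases i <;> fin_cases j
  · simpa [su11] using hc
  · simp [su11]; exact continuous_const
  · simp [su11]; exact continuous_const
  · simp [su11]
    exact Complex.continuous_conj.comp hc

/-- The fibration map `Φ (z, u) = s(z) · rot u`. -/
noncomputable def fib (p : ℂ × Circle) : SU11 := sec p.1 * rot p.2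

/-- `Φ (z, u) = s(z) · rot u`. -/
lemma fib_apply (p : ℂ × Circle) : fib p = sec p.1 * rot p.2 := rfl

/-- The orbit map `g ↦ g · 0` is continuous on `SU11` (the denominator `ḡ₀₀` never vanishes). -/
lemma continuous_orbit : Continuous orbit := by
  have hc : Continuous fun g : SU11 => ((g : Matrix.SpecialLinearGroup (Fin 2) ℂ) : Matrix (Fin 2) (Fin 2) ℂ) :=
    continuous_subtype_val.comp continuous_subtype_val
  have h00 : Continuous fun g : SU11 =>
      ((g : Matrix.SpecialLinearGroup (Fin 2) ℂ) : Matrix (Fin 2) (Fin 2) ℂ) 0 0 :=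
    (continuous_apply 0).comp ((continuous_apply 0).comp hc)
  have h01 : Continuous fun g : SU11 =>
      ((g : Matrix.SpecialLinearGroup (Fin 2) ℂ) : Matrix (Fin 2) (Fin 2) ℂ) 0 1 :=
    (continuous_apply 1).comp ((continuous_apply 0).comp hc)
  have h10 : Continuous fun g : SU11 =>
      ((g : Matrix.SpecialLinearGroup (Fin 2) ℂ) : Matrix (Fin 2) (Fin 2) ℂ) 1 0 :=
    (continuous_apply 0).comp ((continuous_apply 1).comp hc)
  have h11 : Continuous fun g : SU11 =>
      ((g : Matrix.SpecialLinearGroup (Fin 2) ℂ) : Matrix (Fin 2) (Fin 2) ℂ) 1 1 :=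
    (continuous_apply 1).comp ((continuous_apply 1).comp hc)
  have hden : ∀ g : SU11,
      ((g : Matrix.SpecialLinearGroup (Fin 2) ℂ) : Matrix (Fin 2) (Fin 2) ℂ) 1 0 * 0 +
        ((g : Matrix.SpecialLinearGroup (Fin 2) ℂ) : Matrix (Fin 2) (Fin 2) ℂ) 1 1 ≠ 0 := by
    intro g
    rw [mul_zero, zero_add]
    have hmat := coe_eq_su11 g
    have hab := normSq_sub_normSq g
    rw [hmat]
    simp only [su11, Matrix.of_apply, Matrix.cons_val', Matrix.cons_val_one, Matrix.cons_val_fin_one]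
    intro h0
    have : ((g : Matrix.SpecialLinearGroup (Fin 2) ℂ) : Matrix (Fin 2) (Fin 2) ℂ) 0 0 = 0 := by
      simpa using congr_arg (starRingEnd ℂ) h0
    rw [this, map_zero, zero_sub] at hab
    have := Complex.normSq_nonneg
      (((g : Matrix.SpecialLinearGroup (Fin 2) ℂ) : Matrix (Fin 2) (Fin 2) ℂ) 0 1)
    linarith
  unfold orbit mobius
  exact ((h00.mul continuous_const).add h01).div ((h10.mul continuous_const).add h11) hden

/-- `orbit (Φ (z, u)) = z` on the disc. -/
lemma orbit_fib {z : ℂ} (hz : z ∈ ball 0 1) (u : Circle) : orbit (fib (z, u)) = z := by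
  rw [fib_apply, orbit_mul, orbit_rot]
  exact orbit_sec hz

/-- The Poincaré measure of a compact subset of the open disc is finite. -/
lemma poincare_lt_top_of_isCompact {K : Set ℂ} (hK : IsCompact K) (hKb : K ⊆ ball 0 1) :
    poincare K < ∞ := by
  obtain ⟨M, hM⟩ := hK.exists_bound_of_continuousOn (continuousOn_dens.mono hKb)
  unfold poincare
  rw [withDensity_apply _ hK.measurableSet]
  calc ∫⁻ z in K, ENNReal.ofReal (dens z) ∂(volume.restrict (ball 0 1))
      ≤ ∫⁻ _ in K, ENNReal.ofReal M ∂(volume.restrict (ball 0 1)) := by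
        apply setLIntegral_mono measurable_const
        intro z hz
        exact ENNReal.ofReal_le_ofReal ((le_abs_self _).trans (hM z hz))
    _ = ENNReal.ofReal M * (volume.restrict (ball 0 1)) K := setLIntegral_const _ _
    _ ≤ ENNReal.ofReal M * volume K := by
        gcongr
        exact Measure.restrict_le_self
    _ < ∞ := ENNReal.mul_lt_top ENNReal.ofReal_lt_top hK.measure_lt_top

/-- The Poincaré measure vanishes outside the disc. -/
lemma poincare_compl_ball : poincare (ball 0 1)ᶜ = 0 := by
  unfold poincare
  rw [withDensity_apply _ measurableSet_ball.compl, Measure.restrict_restrict measurableSet_ball.compl,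
    Set.compl_inter_self, Measure.restrict_empty, lintegral_zero_measure]

end Summit.Ventures.HodgeRepro2.T5SU11Fibration
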